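import Mathlib.Analysis.Calculus.IteratedDeriv.Lemmas
import Literature.Analysis.Asymptotics.GaussianDamping
import Literature.Geometry.Lorentzian.GaussianBeamPhase
import HarnessLib

/-!
# The eikonal defect of the explicit Gaussian-beam phase vanishes to second order along the
# bicharacteristic
(trunk G08 = T-LORENTZ, geometric optics; namespace `Literature.Geometry.Lorentzian.GaussianBeam`)

Sbierski, Anal. PDE 8 (2015), §3 (= arXiv:1311.2477v2 §2.2): for a Gaussian beam `u_λ = a e^{iλφ}`
the first error term of `□u_λ` is `−λ² (dφ · dφ) a e^{iλφ}` ((3.1)/(3.5)), and the construction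
requires ((3.9)) that the **eikonal defect** `f = ½ g^{μν} ∂_μφ ∂_νφ` "vanishes to second order
along `γ`". With `dφ|_γ = γ̇♭ =: p` the printed computation (arXiv (2.12)–(2.14)) is:
order `0` is the null condition `g⁻¹(p, p) = 0`; order `1`,
`∂_κ f|_γ = ½ (∂_κ g^{μν}) p_μ p_ν + g^{μν} ∂_μφ ∂_κ∂_νφ|_γ = −(∂_κφ)˙ + γ̇^ν ∂_ν∂_κφ = 0`, is the
geodesic (bicharacteristic) equation `ṗ_κ = −½ (∂_κ g^{μν}) p_μ p_ν` together with the compatibility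
`M γ̇ = ṗ`; and order `2` is the matrix Riccati equation `0 = A + BM + MBᵀ + MCM + Ṁ` for
`M = ∂∂φ|_γ`, `A = ½ ∂²g^{μν} p_μ p_ν`, `B_{κρ} = ∂_κ g^{ρν} p_ν`, `C = g^{μν}` ((2.14)).

This file proves that statement for the explicit phase `GaussianBeam.phase P M c` of
`GaussianBeamPhase.lean` in a time-foliated chart `E4 ∋ x = (t, x⃗)`, along the curve
`X(t) = (t, c(t))` carrying real momenta `P(t)`, for an arbitrary smooth symmetric coefficient field
`𝔾 = (g^{μν})` — in the reparametrised form in which the curve is a graph over the time axis: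
`𝔾(X) P = κ Ẋ` with `κ > 0` (`Ẋ = (1, ċ)`; `κ = ṫ ∘ γ` is the energy `−g(N, γ̇)` for `N = −dt♯`),
`Ṗ = −(2κ)⁻¹ ∂𝔾(P, P)` and `κ Ṁ = −(A + BM + MBᵀ + M 𝔾 M)`.

* `GaussianBeam.dG`, `GaussianBeam.ddG`, `GaussianBeam.defect` — the coordinate derivatives of the
  coefficients and the defect `f(x) = ∑ 𝔾^{μν}(x) ∂_μφ(x) ∂_νφ(x)` (twice Sbierski's `f`);
* `dphase_line` — along the spatial lines `s ↦ X(t) + s w` (`w⁰ = 0`) through a curve point the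
  components `∂_μφ` are explicit polynomials of degree `≤ 2` in `s`
  (`lineE + s lineQ + s² lineR`);
* `lineE_eq`, `lineQ_eq_mulVecW` — under the constraint, symmetry and compatibility the constant
  and linear coefficients are `P` and `M w`;
* `sum_G0_mul_P`, `sum_mulVecW_mul_Xd`, `sum_dirDG_PP`, `riccati_contract` — the finite-sum
  algebra: the velocity relation, the compatibility, the bicharacteristic equation and the Riccati
  equation contracted with the direction `w`;
* `defect_curve` (order `0`, the null condition), `hasDerivAt_defect_line`,
  `derivDefectLine_zero`, `hasDerivAt_defect_line_zero` (order `1`, the bicharacteristic equation),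
  `hasDerivAt_derivDefectLine`, `deriv2DefectLine_zero`, `iteratedDeriv_two_defect_line_zero`
  (order `2`, the Riccati equation) — **the defect and its first and second derivatives along every
  spatial line through `X(t)` vanish at `X(t)`**, by the printed computation contracted with
  `w, w`;
* `iteratedFDeriv_eq_zero_of_lines` — the polarisation bridge: for a smooth `F`, vanishing of
  `F`, of the first derivatives and of the second iterated derivatives along all lines through `y₀`
  gives `iteratedFDeriv ℝ k F y₀ = 0` for `k ≤ 2` (the hypothesis of the Gaussian damping lemma
  `Literature.Analysis.Asymptotics.GaussianBeam.gaussianDamping_movingCenter` with `S = 2`);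
  `line_flat_two_mul` — flatness to order `2` along a line survives multiplication by a `C²` factor
  (the amplitude and cut-offs of the beam).

## References

* J. Sbierski, *Characterisation of the energy of Gaussian beams on Lorentzian manifolds: with
  applications to black hole spacetimes*, Anal. PDE 8 (2015) 1379–1420, §3, (3.1), (3.5), (3.9);
  arXiv:1311.2477v2 §2.2, (2.12)–(2.14) (key `Sbierski2015`).
* J. Ralston, *Gaussian beams and the propagation of singularities*, MAA Stud. Math. 23 (1982)
  206–248, §2 (key `Ralston1982`).
-/

noncomputable section

open Set Filter
open scoped ContDiff Topology

namespace Literature.Geometry.Lorentzian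

namespace GaussianBeam

/-! ### Coordinate derivatives of the coefficient field and the eikonal defect -/

/-- `∂_α g^{μν}(x)`: the coordinate derivative of a coefficient. [folklore] -/
def dG (𝔾 : E4 → Fin 4 → Fin 4 → ℝ) (x : E4) (α μ ν : Fin 4) : ℝ :=
  fderiv ℝ (fun y ↦ 𝔾 y μ ν) x (E4.basisVector α)

/-- `∂_α∂_β g^{μν}(x)`. [folklore] -/
def ddG (𝔾 : E4 → Fin 4 → Fin 4 → ℝ) (x : E4) (α β μ ν : Fin 4) : ℝ :=
  fderiv ℝ (fun y ↦ dG 𝔾 y β μ ν) x (E4.basisVector α)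

/-- **The eikonal defect** `f(x) = ∑_{μν} g^{μν}(x) ∂_μφ(x) ∂_νφ(x)` of the explicit phase (twice
Sbierski's `f = ½ g^{μν} ∂_μφ ∂_νφ`, arXiv:1311.2477v2 p. 11; the coefficient of `−λ² a e^{iλφ}` in
`□(a e^{iλφ})`, (3.1)). [cite: Sbierski2015, §3 (3.1), (3.9); arXiv v2 §2.2 (2.12)] -/
def defect (𝔾 : E4 → Fin 4 → Fin 4 → ℝ) (P : ℝ → Fin 4 → ℝ) (M : ℝ → Fin 4 → Fin 4 → ℂ)
    (c : ℝ → E3) (x : E4) : ℂ :=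
  ∑ μ : Fin 4, ∑ ν : Fin 4, (𝔾 x μ ν : ℂ) * dphase P M c μ x * dphase P M c ν x

/-! ### Spatial lines through a curve point -/

section Line

variable (P : ℝ → Fin 4 → ℝ) (M : ℝ → Fin 4 → Fin 4 → ℂ) (c : ℝ → E3)

/-- The time coordinate is constant along a spatial line through `X(t)`. [folklore] -/
theorem line_apply_zero (t : ℝ) {w : E4} (hw : w 0 = 0) (s : ℝ) :
    (E4.ofTimeSpace t (c t) + s • w) 0 = t := by
  simp [hw]

/-- The displacement along a spatial line through `X(t)` is `s w⃗`. [folklore] -/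
theorem disp_line (t : ℝ) {w : E4} (hw : w 0 = 0) (s : ℝ) (i : Fin 3) :
    disp c (E4.ofTimeSpace t (c t) + s • w) i = s * w i.succ := by
  simp [disp, hw]

/-- The constant coefficient of `∂_μφ` along spatial lines: `lineE = (−P⃗ · ċ, P₁, P₂, P₃)`, equal to
`P` under the constraint `P · Ẋ = 0` (`dphase_curve`). [folklore] -/
def lineE (t : ℝ) (μ : Fin 4) : ℂ :=
  Fin.cases (-∑ i : Fin 3, (P t i.succ : ℂ) * (cdot c t i : ℂ)) (fun k ↦ (P t k.succ : ℂ)) μ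

/-- The linear coefficient of `∂_μφ` along the spatial line with direction `w`:
`lineQ₀ = ∑ᵢ Ṗ_{i+1} wᵢ − ½ ∑_{ij} M_{i+1,j+1} (ċᵢ wⱼ + wᵢ ċⱼ)`,
`lineQ_{k+1} = ½ ∑ⱼ (M_{k+1,j+1} + M_{j+1,k+1}) wⱼ` (equal to `M w` under symmetry and
compatibility, `lineQ_eq_mulVec`). [folklore] -/
def lineQ (t : ℝ) (w : E4) (μ : Fin 4) : ℂ :=
  Fin.cases
    (∑ i : Fin 3, (pdot P t i.succ : ℂ) * (w i.succ : ℂ) -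
      2⁻¹ * ∑ i : Fin 3, ∑ j : Fin 3, M t i.succ j.succ *
        ((cdot c t i : ℂ) * (w j.succ : ℂ) + (w i.succ : ℂ) * (cdot c t j : ℂ)))
    (fun k ↦ 2⁻¹ * ∑ j : Fin 3, (M t k.succ j.succ + M t j.succ k.succ) * (w j.succ : ℂ)) μ

/-- The quadratic coefficient of `∂₀φ` along the spatial line with direction `w`:
`lineR = ½ ∑_{ij} Ṁ_{i+1,j+1} wᵢ wⱼ` (the spatial components of `∂φ` are affine). [folklore] -/
def lineR (t : ℝ) (w : E4) : ℂ :=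
  2⁻¹ * ∑ i : Fin 3, ∑ j : Fin 3, mdot M t i.succ j.succ * (w i.succ : ℂ) * (w j.succ : ℂ)

/-- The quadratic coefficient of `∂_μφ` (zero for spatial `μ`). [folklore] -/
def lineR' (t : ℝ) (w : E4) (μ : Fin 4) : ℂ :=
  Fin.cases (lineR M t w) (fun _ ↦ 0) μ

/-- **`∂φ` is an explicit polynomial of degree `≤ 2` along spatial lines through `X(t)`**:
`∂_μφ(X(t) + s w) = lineE_μ + s lineQ_μ + s² lineR'_μ`. [cite: Sbierski2015, §3 (3.12)] -/
theorem dphase_line (t : ℝ) {w : E4} (hw : w 0 = 0) (s : ℝ) (μ : Fin 4) :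
    dphase P M c μ (E4.ofTimeSpace t (c t) + s • w) =
      lineE P c t μ + s * lineQ P M c t w μ + s ^ 2 * lineR' M t w μ := by
  refine Fin.cases ?_ (fun k ↦ ?_) μ
  · simp only [dphase, Fin.cases_zero, line_apply_zero c t hw, disp_line c t hw, lineE, lineQ, lineR',
      lineR]
    have h1 : ∑ i : Fin 3, ((pdot P t i.succ : ℂ) * ((s * w i.succ : ℝ) : ℂ) -
        (P t i.succ : ℂ) * (cdot c t i : ℂ)) =
        -(∑ i : Fin 3, (P t i.succ : ℂ) * (cdot c t i : ℂ)) +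
          (s : ℂ) * ∑ i : Fin 3, (pdot P t i.succ : ℂ) * (w i.succ : ℂ) := by
      rw [Finset.sum_sub_distrib, Finset.mul_sum]
      have e : ∀ i : Fin 3, (pdot P t i.succ : ℂ) * ((s * w i.succ : ℝ) : ℂ) =
          (s : ℂ) * ((pdot P t i.succ : ℂ) * (w i.succ : ℂ)) := fun i ↦ by push_cast; ring
      simp only [e]
      ring
    have h2 : ∑ i : Fin 3, ∑ j : Fin 3, (mdot M t i.succ j.succ * ((s * w i.succ : ℝ) : ℂ) *
        ((s * w j.succ : ℝ) : ℂ) - M t i.succ j.succ * ((cdot c t i : ℂ) * ((s * w j.succ : ℝ) : ℂ) +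
          ((s * w i.succ : ℝ) : ℂ) * (cdot c t j : ℂ))) =
        (s : ℂ) ^ 2 * ∑ i : Fin 3, ∑ j : Fin 3, mdot M t i.succ j.succ * (w i.succ : ℂ) * (w j.succ : ℂ) -
          (s : ℂ) * ∑ i : Fin 3, ∑ j : Fin 3, M t i.succ j.succ *
            ((cdot c t i : ℂ) * (w j.succ : ℂ) + (w i.succ : ℂ) * (cdot c t j : ℂ)) := by
      simp only [Finset.mul_sum, ← Finset.sum_sub_distrib]
      refine Finset.sum_congr rfl fun i _ ↦ Finset.sum_congr rfl fun j _ ↦ ?_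
      push_cast
      ring
    rw [h1, h2]
    ring
  · simp only [dphase, Fin.cases_succ, line_apply_zero c t hw, disp_line c t hw, lineE, lineQ, lineR',
      Complex.ofReal_mul, Finset.mul_sum, mul_zero, add_zero]
    congr 1
    refine Finset.sum_congr rfl fun j _ ↦ ?_
    ring

end Line

/-! ### Finite-sum algebra: contracting the velocity, bicharacteristic and Riccati relations -/

section Algebra

/-- `(M w)_μ = ∑_ν M_{μν} w^ν`. [folklore] -/
def mulVecW (Mm : Fin 4 → Fin 4 → ℂ) (w : E4) (μ : Fin 4) : ℂ := ∑ ν : Fin 4, Mm μ ν * (w ν : ℂ)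

/-- `∑_α w^α ∂_α g^{μν}`: the derivative of the coefficients in the direction `w`, from the
coordinate derivatives. [folklore] -/
def dirDG (dG0 : Fin 4 → Fin 4 → Fin 4 → ℝ) (w : E4) (μ ν : Fin 4) : ℝ := ∑ α : Fin 4, w α * dG0 α μ ν

/-- `∑_{αβ} w^α w^β ∂_α∂_β g^{μν}`: the second derivative of the coefficients in the direction `w`. [folklore] -/
def dirDDG (ddG0 : Fin 4 → Fin 4 → Fin 4 → Fin 4 → ℝ) (w : E4) (μ ν : Fin 4) : ℝ :=
  ∑ α : Fin 4, ∑ β : Fin 4, w α * w β * ddG0 α β μ ν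

/-- Sbierski's `B_{μρ} = ∂_μ g^{ρσ} p_σ` (arXiv:1311.2477v2 (2.14)). [cite: Sbierski2015, §3; arXiv v2 §2.2 (2.14)] -/
def riccatiB (dG0 : Fin 4 → Fin 4 → Fin 4 → ℝ) (Pv : Fin 4 → ℝ) (μ ρ : Fin 4) : ℝ :=
  ∑ σ : Fin 4, dG0 μ ρ σ * Pv σ

/-- Twice Sbierski's `A_{μν} = ½ ∂_μ∂_ν g^{αβ} p_α p_β` (arXiv:1311.2477v2 (2.14)). [cite: Sbierski2015, §3; arXiv v2 §2.2 (2.14)] -/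
def riccatiA2 (ddG0 : Fin 4 → Fin 4 → Fin 4 → Fin 4 → ℝ) (Pv : Fin 4 → ℝ) (μ ν : Fin 4) : ℝ :=
  ∑ α : Fin 4, ∑ β : Fin 4, ddG0 μ ν α β * Pv α * Pv β

variable (G0 : Fin 4 → Fin 4 → ℝ) (dG0 : Fin 4 → Fin 4 → Fin 4 → ℝ)
  (ddG0 : Fin 4 → Fin 4 → Fin 4 → Fin 4 → ℝ) (Pv Xd pd : Fin 4 → ℝ) (w : E4) (κ : ℝ)
  (Mm Md : Fin 4 → Fin 4 → ℂ)

/-- Contracting the velocity relation `∑_ν g^{μν} P_ν = κ Ẋ^μ`: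
`∑_{μν} g^{μν} Z_μ P_ν = κ ∑_μ Z_μ Ẋ^μ`. [folklore] -/
theorem sum_G0_mul_P (hvel : ∀ μ, ∑ ν, G0 μ ν * Pv ν = κ * Xd μ) (Z : Fin 4 → ℂ) :
    ∑ μ, ∑ ν, (G0 μ ν : ℂ) * Z μ * (Pv ν : ℂ) = (κ : ℂ) * ∑ μ, Z μ * (Xd μ : ℂ) := by
  have h : ∀ μ, ∑ ν, (G0 μ ν : ℂ) * Z μ * (Pv ν : ℂ) = (κ : ℂ) * (Z μ * (Xd μ : ℂ)) := by
    intro μ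
    have := congrArg (fun r : ℝ ↦ (r : ℂ)) (hvel μ)
    push_cast at this
    calc ∑ ν, (G0 μ ν : ℂ) * Z μ * (Pv ν : ℂ) = Z μ * ∑ ν, (G0 μ ν : ℂ) * (Pv ν : ℂ) := by
          rw [Finset.mul_sum]; exact Finset.sum_congr rfl fun ν _ ↦ by ring
      _ = Z μ * ((κ : ℂ) * (Xd μ : ℂ)) := by rw [this]
      _ = _ := by ring
  rw [Finset.sum_congr rfl fun μ _ ↦ h μ, ← Finset.mul_sum]

/-- `(M w) · Ẋ = w · Ṗ` for `M` symmetric with `M Ẋ = Ṗ` (arXiv:1311.2477v2 (2.21)). [folklore] -/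
theorem sum_mulVecW_mul_Xd (hsymm : ∀ μ ν, Mm μ ν = Mm ν μ)
    (hcompat : ∀ μ, ∑ ν, Mm μ ν * (Xd ν : ℂ) = (pd μ : ℂ)) :
    ∑ μ, mulVecW Mm w μ * (Xd μ : ℂ) = ∑ ν, (w ν : ℂ) * (pd ν : ℂ) := by
  simp only [mulVecW, Finset.sum_mul]
  rw [Finset.sum_comm]
  refine Finset.sum_congr rfl fun ν _ ↦ ?_
  rw [← hcompat ν, Finset.mul_sum]
  refine Finset.sum_congr rfl fun μ _ ↦ ?_
  rw [hsymm μ ν]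
  ring

/-- Contracting the bicharacteristic equation `∑ ∂_α g^{μν} P_μ P_ν = −2κ Ṗ_α` with `w`. [folklore] -/
theorem sum_dirDG_PP (hbichar : ∀ α, ∑ μ, ∑ ν, dG0 α μ ν * Pv μ * Pv ν = -2 * κ * pd α) :
    ∑ μ, ∑ ν, (dirDG dG0 w μ ν : ℂ) * (Pv μ : ℂ) * (Pv ν : ℂ) =
      -2 * (κ : ℂ) * ∑ α, (w α : ℂ) * (pd α : ℂ) := by
  have h : ∀ α, (∑ μ, ∑ ν, (dG0 α μ ν : ℂ) * (Pv μ : ℂ) * (Pv ν : ℂ)) = -2 * (κ : ℂ) * (pd α : ℂ) := by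
    intro α
    have := congrArg (fun r : ℝ ↦ (r : ℂ)) (hbichar α)
    push_cast at this
    exact this
  have e1 : ∀ μ ν, (dirDG dG0 w μ ν : ℂ) * (Pv μ : ℂ) * (Pv ν : ℂ) =
      ∑ α, (w α : ℂ) * ((dG0 α μ ν : ℂ) * (Pv μ : ℂ) * (Pv ν : ℂ)) := by
    intro μ ν
    simp only [dirDG, Complex.ofReal_sum, Complex.ofReal_mul, Finset.sum_mul]
    exact Finset.sum_congr rfl fun α _ ↦ by ring
  simp only [e1]
  rw [Finset.sum_congr rfl fun μ _ ↦ Finset.sum_comm, Finset.sum_comm]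
  simp only [← Finset.mul_sum]
  rw [Finset.sum_congr rfl fun α _ ↦ by rw [h α], Finset.mul_sum]
  exact Finset.sum_congr rfl fun α _ ↦ by ring

/-- `∑_μ w^μ M_{μρ} = (M w)_ρ` for symmetric `M`. [folklore] -/
theorem sum_w_mul_M (hsymm : ∀ μ ν, Mm μ ν = Mm ν μ) (ρ : Fin 4) :
    ∑ μ, (w μ : ℂ) * Mm μ ρ = mulVecW Mm w ρ := by
  simp only [mulVecW]
  exact Finset.sum_congr rfl fun μ _ ↦ by rw [hsymm μ ρ]; ring

/-- **Contracting the Riccati equation with `w, w`** (arXiv:1311.2477v2 (2.14) with the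
reparametrisation factor `κ`): if `κ Ṁ = −(½·2A + BM + MBᵀ + M g⁻¹ M)` entrywise, then
`κ Ṁ(w, w) = −(½ ∂²_{ww}g⁻¹(P, P) + 2 ∂_w g⁻¹(Mw, P) + g⁻¹(Mw, Mw))`.
[cite: Sbierski2015, §3 (3.9); arXiv v2 §2.2 (2.14)] -/
theorem riccati_contract (hsymm : ∀ μ ν, Mm μ ν = Mm ν μ)
    (hRic : ∀ μ ν, (κ : ℂ) * Md μ ν =
      -(2⁻¹ * (riccatiA2 ddG0 Pv μ ν : ℂ) +
        ∑ ρ, ((riccatiB dG0 Pv μ ρ : ℂ) * Mm ρ ν + Mm μ ρ * (riccatiB dG0 Pv ν ρ : ℂ)) +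
        ∑ ρ, ∑ σ, Mm μ ρ * (G0 ρ σ : ℂ) * Mm σ ν)) :
    (κ : ℂ) * ∑ μ, ∑ ν, (w μ : ℂ) * (w ν : ℂ) * Md μ ν =
      -(2⁻¹ * ∑ μ, ∑ ν, (dirDDG ddG0 w μ ν : ℂ) * (Pv μ : ℂ) * (Pv ν : ℂ) +
        2 * ∑ ρ, ∑ σ, (dirDG dG0 w ρ σ : ℂ) * mulVecW Mm w ρ * (Pv σ : ℂ) +
        ∑ ρ, ∑ σ, mulVecW Mm w ρ * (G0 ρ σ : ℂ) * mulVecW Mm w σ) := by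
  -- contract the entrywise equation with `w_μ w_ν`
  have hsum : (κ : ℂ) * ∑ μ, ∑ ν, (w μ : ℂ) * (w ν : ℂ) * Md μ ν =
      ∑ μ, ∑ ν, (w μ : ℂ) * (w ν : ℂ) *
        -(2⁻¹ * (riccatiA2 ddG0 Pv μ ν : ℂ) +
          ∑ ρ, ((riccatiB dG0 Pv μ ρ : ℂ) * Mm ρ ν + Mm μ ρ * (riccatiB dG0 Pv ν ρ : ℂ)) +
          ∑ ρ, ∑ σ, Mm μ ρ * (G0 ρ σ : ℂ) * Mm σ ν) := by
    rw [Finset.mul_sum]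
    refine Finset.sum_congr rfl fun μ _ ↦ ?_
    rw [Finset.mul_sum]
    refine Finset.sum_congr rfl fun ν _ ↦ ?_
    rw [← hRic μ ν]
    ring
  rw [hsum]
  -- the four contracted terms
  have TA : ∑ μ, ∑ ν, (w μ : ℂ) * (w ν : ℂ) * (riccatiA2 ddG0 Pv μ ν : ℂ) =
      ∑ α, ∑ β, (dirDDG ddG0 w α β : ℂ) * (Pv α : ℂ) * (Pv β : ℂ) := by
    have e : ∀ μ ν, (w μ : ℂ) * (w ν : ℂ) * (riccatiA2 ddG0 Pv μ ν : ℂ) =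
        ∑ α, ∑ β, (w μ : ℂ) * (w ν : ℂ) * (ddG0 μ ν α β : ℂ) * ((Pv α : ℂ) * (Pv β : ℂ)) := by
      intro μ ν
      simp only [riccatiA2, Complex.ofReal_sum, Complex.ofReal_mul]
      rw [Finset.mul_sum]
      refine Finset.sum_congr rfl fun α _ ↦ ?_
      rw [Finset.mul_sum]
      exact Finset.sum_congr rfl fun β _ ↦ by ring
    simp only [e]
    rw [Finset.sum_congr rfl fun μ _ ↦ Finset.sum_comm, Finset.sum_comm]
    refine Finset.sum_congr rfl fun α _ ↦ ?_
    rw [Finset.sum_congr rfl fun μ _ ↦ Finset.sum_comm, Finset.sum_comm]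
    refine Finset.sum_congr rfl fun β _ ↦ ?_
    simp only [dirDDG, Complex.ofReal_sum, Complex.ofReal_mul, Finset.sum_mul]
    exact Finset.sum_congr rfl fun μ _ ↦ Finset.sum_congr rfl fun ν _ ↦ by ring
  have TB : ∑ μ, ∑ ν, (w μ : ℂ) * (w ν : ℂ) * ∑ ρ, (riccatiB dG0 Pv μ ρ : ℂ) * Mm ρ ν =
      ∑ ρ, ∑ σ, (dirDG dG0 w ρ σ : ℂ) * mulVecW Mm w ρ * (Pv σ : ℂ) := by
    have e1 : ∀ μ, ∑ ν, (w μ : ℂ) * (w ν : ℂ) * ∑ ρ, (riccatiB dG0 Pv μ ρ : ℂ) * Mm ρ ν =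
        ∑ ρ, (w μ : ℂ) * (riccatiB dG0 Pv μ ρ : ℂ) * mulVecW Mm w ρ := by
      intro μ
      simp only [mulVecW, Finset.mul_sum]
      rw [Finset.sum_comm]
      exact Finset.sum_congr rfl fun ρ _ ↦ Finset.sum_congr rfl fun ν _ ↦ by ring
    simp only [e1]
    have e2 : ∀ μ ρ, (w μ : ℂ) * (riccatiB dG0 Pv μ ρ : ℂ) * mulVecW Mm w ρ =
        ∑ σ, (w μ : ℂ) * (dG0 μ ρ σ : ℂ) * (mulVecW Mm w ρ * (Pv σ : ℂ)) := by
      intro μ ρ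
      simp only [riccatiB, Complex.ofReal_sum, Complex.ofReal_mul, Finset.mul_sum, Finset.sum_mul]
      exact Finset.sum_congr rfl fun σ _ ↦ by ring
    simp only [e2]
    rw [Finset.sum_comm]
    refine Finset.sum_congr rfl fun ρ _ ↦ ?_
    rw [Finset.sum_comm]
    refine Finset.sum_congr rfl fun σ _ ↦ ?_
    simp only [dirDG, Complex.ofReal_sum, Complex.ofReal_mul, Finset.sum_mul]
    exact Finset.sum_congr rfl fun μ _ ↦ by ring
  have TB' : ∑ μ, ∑ ν, (w μ : ℂ) * (w ν : ℂ) * ∑ ρ, Mm μ ρ * (riccatiB dG0 Pv ν ρ : ℂ) =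
      ∑ ρ, ∑ σ, (dirDG dG0 w ρ σ : ℂ) * mulVecW Mm w ρ * (Pv σ : ℂ) := by
    rw [Finset.sum_comm]
    convert TB using 3 with ν _ μ _
    rw [Finset.mul_sum, Finset.mul_sum]
    exact Finset.sum_congr rfl fun ρ _ ↦ by rw [hsymm μ ρ]; ring
  have TC : ∑ μ, ∑ ν, (w μ : ℂ) * (w ν : ℂ) * ∑ ρ, ∑ σ, Mm μ ρ * (G0 ρ σ : ℂ) * Mm σ ν =
      ∑ ρ, ∑ σ, mulVecW Mm w ρ * (G0 ρ σ : ℂ) * mulVecW Mm w σ := by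
    have e1 : ∀ μ ν, (w μ : ℂ) * (w ν : ℂ) * ∑ ρ, ∑ σ, Mm μ ρ * (G0 ρ σ : ℂ) * Mm σ ν =
        ∑ ρ, ∑ σ, ((w μ : ℂ) * Mm μ ρ) * (G0 ρ σ : ℂ) * (Mm σ ν * (w ν : ℂ)) := by
      intro μ ν
      rw [Finset.mul_sum]
      refine Finset.sum_congr rfl fun ρ _ ↦ ?_
      rw [Finset.mul_sum]
      exact Finset.sum_congr rfl fun σ _ ↦ by ring
    simp only [e1]
    rw [Finset.sum_congr rfl fun μ _ ↦ Finset.sum_comm, Finset.sum_comm]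
    refine Finset.sum_congr rfl fun ρ _ ↦ ?_
    rw [Finset.sum_congr rfl fun μ _ ↦ Finset.sum_comm, Finset.sum_comm]
    refine Finset.sum_congr rfl fun σ _ ↦ ?_
    rw [← sum_w_mul_M w Mm hsymm ρ]
    simp only [mulVecW, Finset.sum_mul, Finset.mul_sum]
    rw [Finset.sum_comm]
  -- assemble
  have split : ∀ μ ν, (w μ : ℂ) * (w ν : ℂ) *
      -(2⁻¹ * (riccatiA2 ddG0 Pv μ ν : ℂ) +
        ∑ ρ, ((riccatiB dG0 Pv μ ρ : ℂ) * Mm ρ ν + Mm μ ρ * (riccatiB dG0 Pv ν ρ : ℂ)) +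
        ∑ ρ, ∑ σ, Mm μ ρ * (G0 ρ σ : ℂ) * Mm σ ν) =
      -(2⁻¹ * ((w μ : ℂ) * (w ν : ℂ) * (riccatiA2 ddG0 Pv μ ν : ℂ)) +
        ((w μ : ℂ) * (w ν : ℂ) * ∑ ρ, (riccatiB dG0 Pv μ ρ : ℂ) * Mm ρ ν +
         (w μ : ℂ) * (w ν : ℂ) * ∑ ρ, Mm μ ρ * (riccatiB dG0 Pv ν ρ : ℂ)) +
        (w μ : ℂ) * (w ν : ℂ) * ∑ ρ, ∑ σ, Mm μ ρ * (G0 ρ σ : ℂ) * Mm σ ν) := by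
    intro μ ν
    rw [Finset.sum_add_distrib]
    ring
  rw [Finset.sum_congr rfl fun μ _ ↦ Finset.sum_congr rfl fun ν _ ↦ split μ ν]
  simp only [Finset.sum_add_distrib, Finset.sum_neg_distrib, ← Finset.mul_sum]
  rw [TA, TB, TB', TC]
  ring

/-- The symmetric combination: `∑ G_{μν} (A_μ B_ν + B_μ A_ν) = 2 ∑ G_{μν} A_μ B_ν` for symmetric
`G`. [folklore] -/
theorem sum_symm_comb (G : Fin 4 → Fin 4 → ℂ) (hG : ∀ μ ν, G μ ν = G ν μ) (A B : Fin 4 → ℂ) :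
    ∑ μ, ∑ ν, G μ ν * (A μ * B ν + B μ * A ν) = 2 * ∑ μ, ∑ ν, G μ ν * A μ * B ν := by
  have h : ∑ μ, ∑ ν, G μ ν * (B μ * A ν) = ∑ μ, ∑ ν, G μ ν * A μ * B ν := by
    rw [Finset.sum_comm]
    exact Finset.sum_congr rfl fun μ _ ↦ Finset.sum_congr rfl fun ν _ ↦ by rw [hG ν μ]; ring
  simp only [mul_add, Finset.sum_add_distrib, h]
  rw [two_mul]
  congr 1
  exact Finset.sum_congr rfl fun μ _ ↦ Finset.sum_congr rfl fun ν _ ↦ by ring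

end Algebra


/-! ### The line coefficients under the constraints: `lineE = P`, `lineQ = M w` -/

section LineCoeff

variable (P : ℝ → Fin 4 → ℝ) (M : ℝ → Fin 4 → Fin 4 → ℂ) (c : ℝ → E3)

/-- The graph velocity `Ẋ = (1, ċ)` of the curve `X(t) = (t, c(t))`. [folklore] -/
def xdot (c : ℝ → E3) (t : ℝ) (μ : Fin 4) : ℝ := Fin.cases 1 (fun k ↦ cdot c t k) μ

/-- `lineE = P` under the constraint `P · Ẋ = 0`. [cite: Sbierski2015, §3 (3.12)] -/
theorem lineE_eq (t : ℝ) (hPX : P t 0 + ∑ i : Fin 3, P t i.succ * cdot c t i = 0) (μ : Fin 4) :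
    lineE P c t μ = (P t μ : ℂ) := by
  refine Fin.cases ?_ (fun k ↦ ?_) μ
  · simp only [lineE, Fin.cases_zero]
    have := congrArg ((↑) : ℝ → ℂ) hPX
    push_cast at this
    linear_combination -this
  · simp [lineE]

/-- `(M w)_μ` has only spatial contributions for a spatial direction (`w⁰ = 0`). [folklore] -/
theorem mulVecW_eq_sum_succ (Mm : Fin 4 → Fin 4 → ℂ) {w : E4} (hw : w 0 = 0) (μ : Fin 4) :
    mulVecW Mm w μ = ∑ j : Fin 3, Mm μ j.succ * (w j.succ : ℂ) := by
  rw [mulVecW, Fin.sum_univ_succ, hw]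
  simp

/-- **`lineQ = M w`**: for `M(t)` symmetric and compatible (`M Ẋ = Ṗ`) the linear coefficient of
`∂φ` along the spatial line with direction `w` is `M w` (the time component through the
compatibility, arXiv:1311.2477v2 (2.21)). [cite: Sbierski2015, §3; arXiv v2 §2.2 (2.21)] -/
theorem lineQ_eq_mulVecW (t : ℝ) {w : E4} (hw : w 0 = 0) (hsymm : ∀ μ ν, M t μ ν = M t ν μ)
    (hMX : ∀ μ, ∑ ν : Fin 4, M t μ ν * (xdot c t ν : ℂ) = (pdot P t μ : ℂ)) (μ : Fin 4) :
    lineQ P M c t w μ = mulVecW (M t) w μ := by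
  rw [mulVecW_eq_sum_succ (M t) hw]
  -- the rows of the compatibility
  have hrow : ∀ l : Fin 3, M t l.succ 0 =
      (pdot P t l.succ : ℂ) - ∑ i : Fin 3, M t l.succ i.succ * (cdot c t i : ℂ) := fun l ↦ by
    have h := hMX l.succ
    rw [Fin.sum_univ_succ] at h
    simp only [xdot, Fin.cases_zero, Fin.cases_succ, Complex.ofReal_one, mul_one] at h
    linear_combination h
  refine Fin.cases ?_ (fun k ↦ ?_) μ
  · -- time component
    simp only [lineQ, Fin.cases_zero]
    have hj : ∀ j : Fin 3, M t 0 j.succ =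
        (pdot P t j.succ : ℂ) - ∑ i : Fin 3, M t j.succ i.succ * (cdot c t i : ℂ) := fun j ↦ by
      rw [hsymm 0 j.succ]; exact hrow j
    have hR : ∑ j : Fin 3, M t 0 j.succ * (w j.succ : ℂ) =
        ∑ j : Fin 3, ((pdot P t j.succ : ℂ) - ∑ i : Fin 3, M t j.succ i.succ * (cdot c t i : ℂ)) *
          (w j.succ : ℂ) := Finset.sum_congr rfl fun j _ ↦ by rw [hj j]
    -- the symmetrised double sum equals `2 ∑_{ij} M_{i+1,j+1} ċ_i w_j`
    have hs : ∑ i : Fin 3, ∑ j : Fin 3, M t i.succ j.succ *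
        ((cdot c t i : ℂ) * (w j.succ : ℂ) + (w i.succ : ℂ) * (cdot c t j : ℂ)) =
        2 * ∑ i : Fin 3, ∑ j : Fin 3, M t i.succ j.succ * (cdot c t i : ℂ) * (w j.succ : ℂ) := by
      have h2 : ∑ i : Fin 3, ∑ j : Fin 3, M t i.succ j.succ * ((w i.succ : ℂ) * (cdot c t j : ℂ)) =
          ∑ i : Fin 3, ∑ j : Fin 3, M t i.succ j.succ * (cdot c t i : ℂ) * (w j.succ : ℂ) := by
        rw [Finset.sum_comm]
        exact Finset.sum_congr rfl fun i _ ↦ Finset.sum_congr rfl fun j _ ↦ by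
          rw [hsymm j.succ i.succ]; ring
      simp only [mul_add, Finset.sum_add_distrib, h2]
      rw [two_mul]
      congr 1
      exact Finset.sum_congr rfl fun i _ ↦ Finset.sum_congr rfl fun j _ ↦ by ring
    have key : ∑ i : Fin 3, ∑ j : Fin 3, M t i.succ j.succ * (cdot c t i : ℂ) * (w j.succ : ℂ) =
        ∑ j : Fin 3, ∑ i : Fin 3, M t j.succ i.succ * (cdot c t i : ℂ) * (w j.succ : ℂ) := by
      rw [Finset.sum_comm]
      exact Finset.sum_congr rfl fun j _ ↦ Finset.sum_congr rfl fun i _ ↦ by rw [hsymm i.succ j.succ]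
    rw [hR, hs, key]
    simp only [sub_mul, Finset.sum_sub_distrib, Finset.sum_mul]
    ring
  · -- spatial components
    simp only [lineQ, Fin.cases_succ, Finset.mul_sum]
    refine Finset.sum_congr rfl fun j _ ↦ ?_
    rw [hsymm j.succ k.succ]
    ring

/-- `lineR = ½ Ṁ(w, w)` written over all four indices (the direction being spatial). [folklore] -/
theorem lineR_eq (t : ℝ) {w : E4} (hw : w 0 = 0) :
    lineR M t w = 2⁻¹ * ∑ μ : Fin 4, ∑ ν : Fin 4, (w μ : ℂ) * (w ν : ℂ) * mdot M t μ ν := by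
  symm
  rw [Fin.sum_univ_succ, hw]
  simp only [Complex.ofReal_zero, zero_mul, Finset.sum_const_zero, zero_add, lineR]
  congr 1
  refine Finset.sum_congr rfl fun i _ ↦ ?_
  rw [Fin.sum_univ_succ, hw]
  simp only [Complex.ofReal_zero, mul_zero, zero_mul, zero_add]
  exact Finset.sum_congr rfl fun j _ ↦ by ring

/-- `∑_μ R'_μ Ẋ^μ = lineR` (only the time component of `R'` is nonzero and `Ẋ⁰ = 1`). [folklore] -/
theorem sum_lineR'_mul_xdot (t : ℝ) (w : E4) :
    ∑ μ : Fin 4, lineR' M t w μ * (xdot c t μ : ℂ) = lineR M t w := by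
  rw [Fin.sum_univ_succ]
  simp [lineR', xdot]

end LineCoeff


/-! ### Directional derivatives of the coefficients from the coordinate ones -/

/-- The line `s ↦ x₀ + s w` has velocity `w`. [folklore] -/
theorem hasDerivAt_lineMap (x₀ w : E4) (s : ℝ) : HasDerivAt (fun s : ℝ ↦ x₀ + s • w) w s := by
  simpa using ((hasDerivAt_id s).smul_const w).const_add x₀

section Coeff

variable (𝔾 : E4 → Fin 4 → Fin 4 → ℝ)

/-- A vector of `E4` in the coordinate basis: `w = ∑_α w^α ∂_α`. [folklore] -/
theorem eq_sum_smul_basisVector (w : E4) : w = ∑ α : Fin 4, w α • E4.basisVector α := by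
  conv_lhs => rw [← (EuclideanSpace.basisFun (Fin 4) ℝ).sum_repr w]
  simp [E4.basisVector]

/-- `D(g^{μν})(x)(w) = ∑_α w^α ∂_α g^{μν}(x)` (linearity of the Fréchet derivative in the
direction). [folklore] -/
theorem fderiv_dir_eq_dirDG (x w : E4) (μ ν : Fin 4) :
    fderiv ℝ (fun y ↦ 𝔾 y μ ν) x w = dirDG (dG 𝔾 x) w μ ν := by
  conv_lhs => rw [eq_sum_smul_basisVector w]
  simp only [map_sum, map_smul, smul_eq_mul, dirDG, dG]

/-- `D²(g^{μν})(x)(w, w) = ∑_{αβ} w^α w^β ∂_α∂_β g^{μν}(x)`, where the coordinate derivatives are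
differentiable at `x`. [folklore] -/
theorem fderiv_dir_dir_eq_dirDDG (x w : E4) (μ ν : Fin 4)
    (hd : ∀ β, DifferentiableAt ℝ (fun y ↦ dG 𝔾 y β μ ν) x) :
    fderiv ℝ (fun y ↦ fderiv ℝ (fun z ↦ 𝔾 z μ ν) y w) x w = dirDDG (ddG 𝔾 x) w μ ν := by
  have hfun : (fun y ↦ fderiv ℝ (fun z ↦ 𝔾 z μ ν) y w) = fun y ↦ ∑ β : Fin 4, w β * dG 𝔾 y β μ ν := by
    funext y
    rw [fderiv_dir_eq_dirDG]
    rfl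
  rw [hfun]
  have hsum : HasFDerivAt (fun y ↦ ∑ β : Fin 4, w β * dG 𝔾 y β μ ν)
      (∑ β : Fin 4, w β • fderiv ℝ (fun y ↦ dG 𝔾 y β μ ν) x) x :=
    HasFDerivAt.fun_sum fun β _ ↦ ((hd β).hasFDerivAt.const_mul (w β)).congr_fderiv (by simp)
  rw [hsum.fderiv, sum_apply]
  simp only [smul_apply, smul_eq_mul]
  have e : ∀ β, fderiv ℝ (fun y ↦ dG 𝔾 y β μ ν) x w = ∑ α : Fin 4, w α * ddG 𝔾 x α β μ ν := by
    intro β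
    conv_lhs => rw [eq_sum_smul_basisVector w]
    simp only [map_sum, map_smul, smul_eq_mul, ddG]
  simp only [e, dirDDG, Finset.mul_sum]
  rw [Finset.sum_comm]
  exact Finset.sum_congr rfl fun α _ ↦ Finset.sum_congr rfl fun β _ ↦ by ring

variable {V : Set E4} (hV : IsOpen V) (h𝔾 : ∀ μ ν, ContDiffOn ℝ ∞ (fun x ↦ 𝔾 x μ ν) V)
include hV h𝔾

/-- The coefficients are differentiable on `V`. [folklore] -/
theorem differentiableAt_coeff {x : E4} (hx : x ∈ V) (μ ν : Fin 4) :
    DifferentiableAt ℝ (fun y ↦ 𝔾 y μ ν) x :=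
  ((h𝔾 μ ν).contDiffAt (hV.mem_nhds hx)).differentiableAt (by simp)

/-- The directional derivatives `y ↦ D(g^{μν})(y)(w)` are `C^∞` on `V`. [folklore] -/
theorem contDiffOn_fderiv_coeff_apply (w : E4) (μ ν : Fin 4) :
    ContDiffOn ℝ ∞ (fun y ↦ fderiv ℝ (fun z ↦ 𝔾 z μ ν) y w) V :=
  ((h𝔾 μ ν).fderiv_of_isOpen hV le_rfl).clm_apply contDiffOn_const

/-- The coordinate derivatives `∂_β g^{μν}` are differentiable on `V`. [folklore] -/
theorem differentiableAt_dG {x : E4} (hx : x ∈ V) (β μ ν : Fin 4) :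
    DifferentiableAt ℝ (fun y ↦ dG 𝔾 y β μ ν) x :=
  ((contDiffOn_fderiv_coeff_apply 𝔾 hV h𝔾 (E4.basisVector β) μ ν).contDiffAt
    (hV.mem_nhds hx)).differentiableAt (by simp)

/-- **The coefficients along a line**: `d/ds g^{μν}(x₀ + s w) = D(g^{μν})(x₀ + s w)(w)` at points of
`V`. [folklore] -/
theorem hasDerivAt_coeff_line {x₀ w : E4} {s : ℝ} (hs : x₀ + s • w ∈ V) (μ ν : Fin 4) :
    HasDerivAt (fun s : ℝ ↦ 𝔾 (x₀ + s • w) μ ν) (fderiv ℝ (fun y ↦ 𝔾 y μ ν) (x₀ + s • w) w) s :=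
  (differentiableAt_coeff 𝔾 hV h𝔾 hs μ ν).hasFDerivAt.comp_hasDerivAt_of_eq s
    (hasDerivAt_lineMap x₀ w s) rfl

/-- **The directional derivative along a line, differentiated once more at the base point**:
`d/ds|₀ D(g^{μν})(x₀ + s w)(w) = ∑_{αβ} w^α w^β ∂_α∂_β g^{μν}(x₀)`. [folklore] -/
theorem hasDerivAt_fderiv_coeff_line {x₀ : E4} (hx₀ : x₀ ∈ V) (w : E4) (μ ν : Fin 4) :
    HasDerivAt (fun s : ℝ ↦ fderiv ℝ (fun y ↦ 𝔾 y μ ν) (x₀ + s • w) w)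
      (dirDDG (ddG 𝔾 x₀) w μ ν) 0 := by
  have hd : DifferentiableAt ℝ (fun y ↦ fderiv ℝ (fun z ↦ 𝔾 z μ ν) y w) x₀ :=
    ((contDiffOn_fderiv_coeff_apply 𝔾 hV h𝔾 w μ ν).contDiffAt (hV.mem_nhds hx₀)).differentiableAt
      (by simp)
  have h := hd.hasFDerivAt.comp_hasDerivAt_of_eq (0 : ℝ) (hasDerivAt_lineMap x₀ w 0) (by simp)
  rw [fderiv_dir_dir_eq_dirDDG 𝔾 x₀ w μ ν (fun β ↦ differentiableAt_dG 𝔾 hV h𝔾 hx₀ β μ ν)] at h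
  exact h

end Coeff


/-! ### The defect along spatial lines through a curve point: orders `0`, `1`, `2` -/

section Vanishing

variable (𝔾 : E4 → Fin 4 → Fin 4 → ℝ) (P : ℝ → Fin 4 → ℝ) (M : ℝ → Fin 4 → Fin 4 → ℂ) (c : ℝ → E3)

/-- The components `∂_μφ` along the spatial line `s ↦ X(t) + s w`, as polynomials in `s`
(`dphase_line`). [folklore] -/
def lineDphase (t : ℝ) (w : E4) (μ : Fin 4) (s : ℝ) : ℂ :=
  lineE P c t μ + s * lineQ P M c t w μ + s ^ 2 * lineR' M t w μ

/-- Derivative of the line polynomial. [folklore] -/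
theorem hasDerivAt_lineDphase (t : ℝ) (w : E4) (μ : Fin 4) (s : ℝ) :
    HasDerivAt (lineDphase P M c t w μ) (lineQ P M c t w μ + 2 * s * lineR' M t w μ) s := by
  unfold lineDphase
  have h1 : HasDerivAt (fun s : ℝ ↦ (s : ℂ) * lineQ P M c t w μ) (lineQ P M c t w μ) s := by
    simpa using (HasDerivAt.ofReal_comp (hasDerivAt_id s)).mul_const (lineQ P M c t w μ)
  have h2 : HasDerivAt (fun s : ℝ ↦ (s : ℂ) ^ 2 * lineR' M t w μ) (2 * s * lineR' M t w μ) s := by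
    have := ((HasDerivAt.ofReal_comp (hasDerivAt_id s)).pow 2).mul_const (lineR' M t w μ)
    simpa using this
  exact (h1.const_add (lineE P c t μ)).add h2

/-- Second derivative of the line polynomial. [folklore] -/
theorem hasDerivAt_deriv_lineDphase (t : ℝ) (w : E4) (μ : Fin 4) (s : ℝ) :
    HasDerivAt (fun s : ℝ ↦ lineQ P M c t w μ + 2 * s * lineR' M t w μ) (2 * lineR' M t w μ) s := by
  have h : HasDerivAt (fun s : ℝ ↦ 2 * (s : ℂ) * lineR' M t w μ) (2 * lineR' M t w μ) s := by
    have := ((HasDerivAt.ofReal_comp (hasDerivAt_id s)).const_mul (2 : ℂ)).mul_const (lineR' M t w μ)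
    simpa using this
  simpa using h.const_add (lineQ P M c t w μ)

/-- **The defect along a spatial line through `X(t)`** is `∑ g^{μν}(X + s w) e_μ(s) e_ν(s)` with
the explicit line polynomials `e_μ`. [cite: Sbierski2015, §3 (3.9)] -/
theorem defect_line_eq (t : ℝ) {w : E4} (hw : w 0 = 0) (s : ℝ) :
    defect 𝔾 P M c (E4.ofTimeSpace t (c t) + s • w) =
      ∑ μ : Fin 4, ∑ ν : Fin 4, (𝔾 (E4.ofTimeSpace t (c t) + s • w) μ ν : ℂ) *
        lineDphase P M c t w μ s * lineDphase P M c t w ν s := by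
  simp only [defect, dphase_line P M c t hw, lineDphase]

/-- The derivative of the defect along the line (product rule), as an explicit function of `s`. [folklore] -/
def derivDefectLine (t : ℝ) (w : E4) (s : ℝ) : ℂ :=
  ∑ μ : Fin 4, ∑ ν : Fin 4,
    ((fderiv ℝ (fun y ↦ 𝔾 y μ ν) (E4.ofTimeSpace t (c t) + s • w) w : ℂ) *
        lineDphase P M c t w μ s * lineDphase P M c t w ν s +
      (𝔾 (E4.ofTimeSpace t (c t) + s • w) μ ν : ℂ) *
        ((lineQ P M c t w μ + 2 * s * lineR' M t w μ) * lineDphase P M c t w ν s +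
          lineDphase P M c t w μ s * (lineQ P M c t w ν + 2 * s * lineR' M t w ν)))

variable {V : Set E4} (hV : IsOpen V) (h𝔾 : ∀ μ ν, ContDiffOn ℝ ∞ (fun x ↦ 𝔾 x μ ν) V)
include hV h𝔾

/-- **First derivative of the defect along the line** at every parameter where the line lies in
`V`. [cite: Sbierski2015, §3 (3.9); arXiv v2 §2.2 (2.12)] -/
theorem hasDerivAt_defect_line (t : ℝ) {w : E4} (hw : w 0 = 0) {s : ℝ}
    (hs : E4.ofTimeSpace t (c t) + s • w ∈ V) :
    HasDerivAt (fun s : ℝ ↦ defect 𝔾 P M c (E4.ofTimeSpace t (c t) + s • w))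
      (derivDefectLine 𝔾 P M c t w s) s := by
  have hfun : (fun s : ℝ ↦ defect 𝔾 P M c (E4.ofTimeSpace t (c t) + s • w)) = fun s ↦
      ∑ μ : Fin 4, ∑ ν : Fin 4, (𝔾 (E4.ofTimeSpace t (c t) + s • w) μ ν : ℂ) *
        lineDphase P M c t w μ s * lineDphase P M c t w ν s :=
    funext fun s ↦ defect_line_eq 𝔾 P M c t hw s
  rw [hfun]
  have hG : ∀ μ ν, HasDerivAt (fun s : ℝ ↦ (𝔾 (E4.ofTimeSpace t (c t) + s • w) μ ν : ℂ))
      ((fderiv ℝ (fun y ↦ 𝔾 y μ ν) (E4.ofTimeSpace t (c t) + s • w) w : ℝ) : ℂ) s := fun μ ν ↦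
    HasDerivAt.ofReal_comp (hasDerivAt_coeff_line 𝔾 hV h𝔾 hs μ ν)
  have he := hasDerivAt_lineDphase P M c t w
  have h := HasDerivAt.fun_sum (u := Finset.univ) fun μ (_ : μ ∈ Finset.univ) ↦
    HasDerivAt.fun_sum (u := Finset.univ) fun ν (_ : ν ∈ Finset.univ) ↦
      ((hG μ ν).mul (he μ s)).mul (he ν s)
  refine h.congr_deriv ?_
  simp only [derivDefectLine]
  exact Finset.sum_congr rfl fun μ _ ↦ Finset.sum_congr rfl fun ν _ ↦ by
    simp only [Pi.mul_apply]; ring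

omit hV h𝔾 in
/-- The value of the line polynomial and of its derivative at the curve point. [folklore] -/
theorem lineDphase_zero (t : ℝ) (w : E4) (μ : Fin 4) : lineDphase P M c t w μ 0 = lineE P c t μ := by
  simp [lineDphase]

omit hV h𝔾 in
/-- **The first derivative at the curve point, in closed form**:
`h'(0) = ∑ (∂_w g^{μν}) E_μ E_ν + g^{μν} (Q_μ E_ν + E_μ Q_ν)`. [cite: Sbierski2015, §3; arXiv v2 §2.2 (2.12)] -/
theorem derivDefectLine_zero_eq (t : ℝ) (w : E4) :
    derivDefectLine 𝔾 P M c t w 0 =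
      ∑ μ : Fin 4, ∑ ν : Fin 4,
        ((dirDG (dG 𝔾 (E4.ofTimeSpace t (c t))) w μ ν : ℂ) * lineE P c t μ * lineE P c t ν +
          (𝔾 (E4.ofTimeSpace t (c t)) μ ν : ℂ) *
            (lineQ P M c t w μ * lineE P c t ν + lineE P c t μ * lineQ P M c t w ν)) := by
  simp only [derivDefectLine, zero_smul, add_zero, lineDphase_zero, fderiv_dir_eq_dirDG,
    Complex.ofReal_zero, mul_zero, zero_mul]

omit hV h𝔾 in
/-- **Order 0: the defect vanishes on the curve** — the null condition `g⁻¹(P, P) = 0`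
(arXiv:1311.2477v2 p. 11: "Since `γ̇` is a null vector, we clearly have `dφ · dφ = 0` along `γ`").
[cite: Sbierski2015, §3 (3.9); arXiv v2 §2.2 p. 11] -/
theorem defect_curve (t : ℝ) (hPX : P t 0 + ∑ i : Fin 3, P t i.succ * cdot c t i = 0)
    (hnull : ∑ μ : Fin 4, ∑ ν : Fin 4, 𝔾 (E4.ofTimeSpace t (c t)) μ ν * P t μ * P t ν = 0) :
    defect 𝔾 P M c (E4.ofTimeSpace t (c t)) = 0 := by
  simp only [defect, dphase_curve P M c t hPX]
  have := congrArg ((↑) : ℝ → ℂ) hnull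
  push_cast at this
  exact this

omit hV h𝔾 in
/-- The coordinate derivatives of symmetric coefficients are symmetric. [folklore] -/
theorem dG_symm (hGsymm : ∀ x μ ν, 𝔾 x μ ν = 𝔾 x ν μ) (x : E4) (α μ ν : Fin 4) :
    dG 𝔾 x α μ ν = dG 𝔾 x α ν μ := by
  simp only [dG, show (fun y ↦ 𝔾 y μ ν) = fun y ↦ 𝔾 y ν μ from funext fun y ↦ hGsymm y μ ν]

omit hV h𝔾 in
/-- **Order 1: the first derivative of the defect along every spatial line vanishes at the curve
point** — the bicharacteristic (geodesic) equation with the compatibility `M Ẋ = Ṗ`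
(arXiv:1311.2477v2 (2.12)–(2.13): `∂_κ f|_γ = −(∂_κφ)˙ + γ̇^ν ∂_ν∂_κφ = 0`), contracted with
`w`. [cite: Sbierski2015, §3 (3.9); arXiv v2 §2.2 (2.12)–(2.13)] -/
theorem derivDefectLine_zero (t : ℝ) {w : E4} (hw : w 0 = 0)
    (hGsymm : ∀ x μ ν, 𝔾 x μ ν = 𝔾 x ν μ)
    (hPX : P t 0 + ∑ i : Fin 3, P t i.succ * cdot c t i = 0)
    (hsymm : ∀ μ ν, M t μ ν = M t ν μ)
    (hMX : ∀ μ, ∑ ν : Fin 4, M t μ ν * (xdot c t ν : ℂ) = (pdot P t μ : ℂ)) {κ : ℝ}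
    (hvel : ∀ μ, ∑ ν : Fin 4, 𝔾 (E4.ofTimeSpace t (c t)) μ ν * P t ν = κ * xdot c t μ)
    (hbichar : ∀ α, ∑ μ : Fin 4, ∑ ν : Fin 4, dG 𝔾 (E4.ofTimeSpace t (c t)) α μ ν * P t μ * P t ν =
      -2 * κ * pdot P t α) :
    derivDefectLine 𝔾 P M c t w 0 = 0 := by
  rw [derivDefectLine_zero_eq]
  simp only [lineE_eq P c t hPX, lineQ_eq_mulVecW P M c t hw hsymm hMX, Finset.sum_add_distrib]
  -- the `∂g` term: `−2κ w·Ṗ`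
  have h1 := sum_dirDG_PP (dG 𝔾 (E4.ofTimeSpace t (c t))) (P t) (pdot P t) w κ hbichar
  -- the `g` term: `2κ (Mw)·Ẋ = 2κ w·Ṗ`
  have hG0symm : ∀ μ ν, (𝔾 (E4.ofTimeSpace t (c t)) μ ν : ℂ) = (𝔾 (E4.ofTimeSpace t (c t)) ν μ : ℂ) :=
    fun μ ν ↦ by rw [hGsymm]
  have h2 := sum_symm_comb (fun μ ν ↦ (𝔾 (E4.ofTimeSpace t (c t)) μ ν : ℂ)) hG0symm
    (mulVecW (M t) w) (fun ν ↦ (P t ν : ℂ))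
  have h3 := sum_G0_mul_P (𝔾 (E4.ofTimeSpace t (c t))) (P t) (xdot c t) κ hvel (mulVecW (M t) w)
  have h4 := sum_mulVecW_mul_Xd (xdot c t) (pdot P t) w (M t) hsymm hMX
  rw [h1, h2, h3, h4]
  ring

end Vanishing


section Order2

variable (𝔾 : E4 → Fin 4 → Fin 4 → ℝ) (P : ℝ → Fin 4 → ℝ) (M : ℝ → Fin 4 → Fin 4 → ℂ) (c : ℝ → E3)
  {V : Set E4} (hV : IsOpen V) (h𝔾 : ∀ μ ν, ContDiffOn ℝ ∞ (fun x ↦ 𝔾 x μ ν) V)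
include hV h𝔾

/-- **Second derivative of the defect along the line at the curve point** (product rule once more):
`h''(0) = ∑ [∂²_{ww}g E E + 2 ∂_w g (Q E + E Q) + g (2R' E + 2 Q Q + E 2R')]`.
[cite: Sbierski2015, §3 (3.9); arXiv v2 §2.2 (2.14)] -/
theorem hasDerivAt_derivDefectLine (t : ℝ) (w : E4) (hXV : E4.ofTimeSpace t (c t) ∈ V) :
    HasDerivAt (derivDefectLine 𝔾 P M c t w)
      (∑ μ : Fin 4, ∑ ν : Fin 4,
        ((dirDDG (ddG 𝔾 (E4.ofTimeSpace t (c t))) w μ ν : ℂ) * lineE P c t μ * lineE P c t ν +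
          2 * (dirDG (dG 𝔾 (E4.ofTimeSpace t (c t))) w μ ν : ℂ) *
            (lineQ P M c t w μ * lineE P c t ν + lineE P c t μ * lineQ P M c t w ν) +
          (𝔾 (E4.ofTimeSpace t (c t)) μ ν : ℂ) *
            (2 * lineR' M t w μ * lineE P c t ν + 2 * (lineQ P M c t w μ * lineQ P M c t w ν) +
              lineE P c t μ * (2 * lineR' M t w ν)))) 0 := by
  set X := E4.ofTimeSpace t (c t) with hX
  have hX0 : X + (0 : ℝ) • w ∈ V := by simpa using hXV
  -- the coefficient factors
  have hF : ∀ μ ν, HasDerivAt (fun s : ℝ ↦ ((fderiv ℝ (fun y ↦ 𝔾 y μ ν) (X + s • w) w : ℝ) : ℂ))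
      ((dirDDG (ddG 𝔾 X) w μ ν : ℝ) : ℂ) 0 := fun μ ν ↦
    HasDerivAt.ofReal_comp (hasDerivAt_fderiv_coeff_line 𝔾 hV h𝔾 hXV w μ ν)
  have hG : ∀ μ ν, HasDerivAt (fun s : ℝ ↦ (𝔾 (X + s • w) μ ν : ℂ))
      ((dirDG (dG 𝔾 X) w μ ν : ℝ) : ℂ) 0 := by
    intro μ ν
    have h := HasDerivAt.ofReal_comp (hasDerivAt_coeff_line 𝔾 hV h𝔾 hX0 μ ν)
    simp only [zero_smul, add_zero, fderiv_dir_eq_dirDG] at h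
    exact h
  have he := hasDerivAt_lineDphase P M c t w
  have he' := hasDerivAt_deriv_lineDphase P M c t w
  have h := HasDerivAt.fun_sum (u := Finset.univ) fun μ (_ : μ ∈ Finset.univ) ↦
    HasDerivAt.fun_sum (u := Finset.univ) fun ν (_ : ν ∈ Finset.univ) ↦
      ((((hF μ ν).mul (he μ 0)).mul (he ν 0)).add
        ((hG μ ν).mul (((he' μ 0).mul (he ν 0)).add ((he μ 0).mul (he' ν 0)))))
  refine (h.congr_deriv ?_).congr_of_eventuallyEq (Eventually.of_forall fun s ↦ ?_)
  · refine Finset.sum_congr rfl fun μ _ ↦ Finset.sum_congr rfl fun ν _ ↦ ?_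
    simp only [lineDphase_zero, zero_smul, add_zero, Complex.ofReal_zero, mul_zero, zero_mul,
      fderiv_dir_eq_dirDG, Pi.mul_apply, Pi.add_apply]
    ring
  · simp only [derivDefectLine, hX, Pi.mul_apply, Pi.add_apply]

omit hV h𝔾 in
/-- **Order 2: the second derivative of the defect along every spatial line vanishes at the curve
point** — the matrix Riccati equation contracted with `w, w` (arXiv:1311.2477v2 (2.13)–(2.14)),
together with `g^{μν} R'_μ P_ν = κ R'·Ẋ = κ·½ Ṁ(w, w)`. [cite: Sbierski2015, §3 (3.9); arXiv v2 §2.2 (2.13)–(2.14)] -/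
theorem deriv2DefectLine_zero (t : ℝ) {w : E4} (hw : w 0 = 0)
    (hGsymm : ∀ x μ ν, 𝔾 x μ ν = 𝔾 x ν μ)
    (hPX : P t 0 + ∑ i : Fin 3, P t i.succ * cdot c t i = 0)
    (hsymm : ∀ μ ν, M t μ ν = M t ν μ)
    (hMX : ∀ μ, ∑ ν : Fin 4, M t μ ν * (xdot c t ν : ℂ) = (pdot P t μ : ℂ)) {κ : ℝ}
    (hvel : ∀ μ, ∑ ν : Fin 4, 𝔾 (E4.ofTimeSpace t (c t)) μ ν * P t ν = κ * xdot c t μ)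
    (hRic : ∀ μ ν, (κ : ℂ) * mdot M t μ ν =
      -(2⁻¹ * (riccatiA2 (ddG 𝔾 (E4.ofTimeSpace t (c t))) (P t) μ ν : ℂ) +
        ∑ ρ : Fin 4, ((riccatiB (dG 𝔾 (E4.ofTimeSpace t (c t))) (P t) μ ρ : ℂ) * M t ρ ν +
          M t μ ρ * (riccatiB (dG 𝔾 (E4.ofTimeSpace t (c t))) (P t) ν ρ : ℂ)) +
        ∑ ρ : Fin 4, ∑ σ : Fin 4, M t μ ρ * (𝔾 (E4.ofTimeSpace t (c t)) ρ σ : ℂ) * M t σ ν)) :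
    ∑ μ : Fin 4, ∑ ν : Fin 4,
        ((dirDDG (ddG 𝔾 (E4.ofTimeSpace t (c t))) w μ ν : ℂ) * lineE P c t μ * lineE P c t ν +
          2 * (dirDG (dG 𝔾 (E4.ofTimeSpace t (c t))) w μ ν : ℂ) *
            (lineQ P M c t w μ * lineE P c t ν + lineE P c t μ * lineQ P M c t w ν) +
          (𝔾 (E4.ofTimeSpace t (c t)) μ ν : ℂ) *
            (2 * lineR' M t w μ * lineE P c t ν + 2 * (lineQ P M c t w μ * lineQ P M c t w ν) +
              lineE P c t μ * (2 * lineR' M t w ν))) = 0 := by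
  set X := E4.ofTimeSpace t (c t) with hX
  set E : Fin 4 → ℂ := fun μ ↦ (P t μ : ℂ) with hE
  set Q : Fin 4 → ℂ := mulVecW (M t) w with hQ
  set R : Fin 4 → ℂ := lineR' M t w with hR
  simp only [lineE_eq P c t hPX, lineQ_eq_mulVecW P M c t hw hsymm hMX]
  -- symmetric families
  have hG0symm : ∀ μ ν, (𝔾 X μ ν : ℂ) = (𝔾 X ν μ : ℂ) := fun μ ν ↦ by rw [hGsymm]
  have hG1symm : ∀ μ ν, (dirDG (dG 𝔾 X) w μ ν : ℂ) = (dirDG (dG 𝔾 X) w ν μ : ℂ) := by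
    intro μ ν
    simp only [dirDG, dG_symm 𝔾 hGsymm X _ μ ν]
  -- normalise the four groups of terms
  have hsplit : ∑ μ : Fin 4, ∑ ν : Fin 4,
        ((dirDDG (ddG 𝔾 X) w μ ν : ℂ) * (P t μ : ℂ) * (P t ν : ℂ) +
          2 * (dirDG (dG 𝔾 X) w μ ν : ℂ) * (Q μ * (P t ν : ℂ) + (P t μ : ℂ) * Q ν) +
          (𝔾 X μ ν : ℂ) * (2 * R μ * (P t ν : ℂ) + 2 * (Q μ * Q ν) + (P t μ : ℂ) * (2 * R ν))) =
      (∑ μ : Fin 4, ∑ ν : Fin 4, (dirDDG (ddG 𝔾 X) w μ ν : ℂ) * (P t μ : ℂ) * (P t ν : ℂ)) +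
        2 * (∑ μ : Fin 4, ∑ ν : Fin 4, (dirDG (dG 𝔾 X) w μ ν : ℂ) * (Q μ * (P t ν : ℂ) + (P t μ : ℂ) * Q ν)) +
        2 * (∑ μ : Fin 4, ∑ ν : Fin 4, (𝔾 X μ ν : ℂ) * (R μ * (P t ν : ℂ) + (P t μ : ℂ) * R ν)) +
        2 * (∑ μ : Fin 4, ∑ ν : Fin 4, (𝔾 X μ ν : ℂ) * Q μ * Q ν) := by
    simp only [Finset.mul_sum, ← Finset.sum_add_distrib]
    exact Finset.sum_congr rfl fun μ _ ↦ Finset.sum_congr rfl fun ν _ ↦ by ring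
  rw [hsplit]
  have h1 := sum_symm_comb (fun μ ν ↦ (dirDG (dG 𝔾 X) w μ ν : ℂ)) hG1symm Q fun ν ↦ (P t ν : ℂ)
  have h2 := sum_symm_comb (fun μ ν ↦ (𝔾 X μ ν : ℂ)) hG0symm R fun ν ↦ (P t ν : ℂ)
  have h3 := sum_G0_mul_P (𝔾 X) (P t) (xdot c t) κ hvel R
  have h4 : ∑ μ : Fin 4, R μ * (xdot c t μ : ℂ) = lineR M t w := sum_lineR'_mul_xdot M c t w
  have h5 := lineR_eq M t hw
  have h6 := riccati_contract (𝔾 X) (dG 𝔾 X) (ddG 𝔾 X) (P t) w κ (M t) (mdot M t) hsymm hRic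
  have h7 : ∑ ρ : Fin 4, ∑ σ : Fin 4, Q ρ * (𝔾 X ρ σ : ℂ) * Q σ =
      ∑ μ : Fin 4, ∑ ν : Fin 4, (𝔾 X μ ν : ℂ) * Q μ * Q ν :=
    Finset.sum_congr rfl fun μ _ ↦ Finset.sum_congr rfl fun ν _ ↦ by ring
  rw [h1, h2, h3, h4, h5]
  rw [h7] at h6
  linear_combination (2 : ℂ) * h6

omit hV h𝔾 in
/-- **The first derivative along every spatial line vanishes at the curve point** (packaged as a
`HasDerivAt` of the defect itself). [cite: Sbierski2015, §3 (3.9); arXiv v2 §2.2 (2.12)–(2.13)] -/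
theorem hasDerivAt_defect_line_zero (hV : IsOpen V) (h𝔾 : ∀ μ ν, ContDiffOn ℝ ∞ (fun x ↦ 𝔾 x μ ν) V)
    (t : ℝ) {w : E4} (hw : w 0 = 0) (hXV : E4.ofTimeSpace t (c t) ∈ V)
    (hGsymm : ∀ x μ ν, 𝔾 x μ ν = 𝔾 x ν μ)
    (hPX : P t 0 + ∑ i : Fin 3, P t i.succ * cdot c t i = 0)
    (hsymm : ∀ μ ν, M t μ ν = M t ν μ)
    (hMX : ∀ μ, ∑ ν : Fin 4, M t μ ν * (xdot c t ν : ℂ) = (pdot P t μ : ℂ)) {κ : ℝ}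
    (hvel : ∀ μ, ∑ ν : Fin 4, 𝔾 (E4.ofTimeSpace t (c t)) μ ν * P t ν = κ * xdot c t μ)
    (hbichar : ∀ α, ∑ μ : Fin 4, ∑ ν : Fin 4, dG 𝔾 (E4.ofTimeSpace t (c t)) α μ ν * P t μ * P t ν =
      -2 * κ * pdot P t α) :
    HasDerivAt (fun s : ℝ ↦ defect 𝔾 P M c (E4.ofTimeSpace t (c t) + s • w)) 0 0 := by
  have h := hasDerivAt_defect_line 𝔾 P M c hV h𝔾 t hw (s := 0) (by simpa using hXV)
  rwa [derivDefectLine_zero 𝔾 P M c t hw hGsymm hPX hsymm hMX hvel hbichar] at h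

/-- **The second iterated derivative along every spatial line vanishes at the curve point.**
[cite: Sbierski2015, §3 (3.9); arXiv v2 §2.2 (2.13)–(2.14)] -/
theorem iteratedDeriv_two_defect_line_zero (t : ℝ) {w : E4} (hw : w 0 = 0)
    (hXV : E4.ofTimeSpace t (c t) ∈ V)
    (hGsymm : ∀ x μ ν, 𝔾 x μ ν = 𝔾 x ν μ)
    (hPX : P t 0 + ∑ i : Fin 3, P t i.succ * cdot c t i = 0)
    (hsymm : ∀ μ ν, M t μ ν = M t ν μ)
    (hMX : ∀ μ, ∑ ν : Fin 4, M t μ ν * (xdot c t ν : ℂ) = (pdot P t μ : ℂ)) {κ : ℝ}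
    (hvel : ∀ μ, ∑ ν : Fin 4, 𝔾 (E4.ofTimeSpace t (c t)) μ ν * P t ν = κ * xdot c t μ)
    (hRic : ∀ μ ν, (κ : ℂ) * mdot M t μ ν =
      -(2⁻¹ * (riccatiA2 (ddG 𝔾 (E4.ofTimeSpace t (c t))) (P t) μ ν : ℂ) +
        ∑ ρ : Fin 4, ((riccatiB (dG 𝔾 (E4.ofTimeSpace t (c t))) (P t) μ ρ : ℂ) * M t ρ ν +
          M t μ ρ * (riccatiB (dG 𝔾 (E4.ofTimeSpace t (c t))) (P t) ν ρ : ℂ)) +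
        ∑ ρ : Fin 4, ∑ σ : Fin 4, M t μ ρ * (𝔾 (E4.ofTimeSpace t (c t)) ρ σ : ℂ) * M t σ ν)) :
    iteratedDeriv 2 (fun s : ℝ ↦ defect 𝔾 P M c (E4.ofTimeSpace t (c t) + s • w)) 0 = 0 := by
  -- the line stays in `V` near `s = 0`
  have hcont : Continuous fun s : ℝ ↦ E4.ofTimeSpace t (c t) + s • w := by fun_prop
  have hnear : ∀ᶠ s in 𝓝 (0 : ℝ), E4.ofTimeSpace t (c t) + s • w ∈ V := by
    have : (fun s : ℝ ↦ E4.ofTimeSpace t (c t) + s • w) ⁻¹' V ∈ 𝓝 (0 : ℝ) :=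
      hcont.continuousAt.preimage_mem_nhds (by simpa using hV.mem_nhds hXV)
    exact this
  -- `deriv (defect ∘ line) = derivDefectLine` near `0`
  have hderiv : deriv (fun s : ℝ ↦ defect 𝔾 P M c (E4.ofTimeSpace t (c t) + s • w)) =ᶠ[𝓝 0]
      derivDefectLine 𝔾 P M c t w := by
    filter_upwards [hnear] with s hs
    exact (hasDerivAt_defect_line 𝔾 P M c hV h𝔾 t hw hs).deriv
  rw [iteratedDeriv_succ, iteratedDeriv_one, hderiv.deriv_eq,
    (hasDerivAt_derivDefectLine 𝔾 P M c hV h𝔾 t w hXV).deriv]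
  exact deriv2DefectLine_zero 𝔾 P M c t hw hGsymm hPX hsymm hMX hvel hRic

end Order2


/-! ### From vanishing along lines to vanishing transversal Fréchet derivatives (orders `≤ 2`) -/

section Bridge

variable {W : Type*} [NormedAddCommGroup W] [InnerProductSpace ℝ W]
  {F' : Type*} [NormedAddCommGroup F'] [NormedSpace ℝ F']

/-- **Polarisation bridge.** For a `C^∞` function `F`, if `F(y₀) = 0` and along every line
`s ↦ y₀ + s u` the first derivative and the second iterated derivative vanish at `s = 0`, then the
Fréchet derivatives of `F` of orders `0, 1, 2` vanish at `y₀` (the second by the symmetry of the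
second derivative and polarisation) — the form of "vanishing to order `2`" used by the Gaussian
damping lemma (`Literature.Analysis.Asymptotics.GaussianBeam.gaussianDamping`). [folklore] -/
theorem iteratedFDeriv_eq_zero_of_lines {F : W → F'} (hF : ContDiff ℝ ∞ F) {y₀ : W}
    (h0 : F y₀ = 0) (h1 : ∀ u : W, HasDerivAt (fun s : ℝ ↦ F (y₀ + s • u)) 0 0)
    (h2 : ∀ u : W, iteratedDeriv 2 (fun s : ℝ ↦ F (y₀ + s • u)) 0 = 0) :
    ∀ k ≤ 2, iteratedFDeriv ℝ k F y₀ = 0 := by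
  -- first derivatives
  have hd1 : ∀ u : W, fderiv ℝ F y₀ u = 0 := by
    intro u
    have hline : HasDerivAt (fun s : ℝ ↦ y₀ + s • u) u 0 := by
      simpa using ((hasDerivAt_id (0 : ℝ)).smul_const u).const_add y₀
    have h := (hF.differentiable (by simp) y₀).hasFDerivAt.comp_hasDerivAt_of_eq (0 : ℝ) hline
      (by simp)
    exact h.unique (h1 u)
  -- second derivatives on the diagonal, through the lines
  have hd2 : ∀ u : W, fderiv ℝ (fderiv ℝ F) y₀ u u = 0 := by
    intro u
    set G : W → F' := fun z ↦ F (z + y₀) with hG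
    have hGd : ContDiff ℝ ∞ G := hF.comp (contDiff_id.add contDiff_const)
    have hfun : (fun s : ℝ ↦ F (y₀ + s • u)) = fun s : ℝ ↦ G (s • u) := by
      funext s; simp [hG, add_comm]
    have h := Literature.Analysis.Asymptotics.GaussianBeam.iteratedDeriv_comp_smul (n := 2) hGd u
      (by exact_mod_cast le_top) 0
    rw [← hfun, h2 u, zero_smul] at h
    have hG2 : iteratedFDeriv ℝ 2 G 0 = iteratedFDeriv ℝ 2 F y₀ := by
      rw [hG, iteratedFDeriv_comp_add_right, zero_add]
    rw [hG2, iteratedFDeriv_two_apply] at h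
    exact h.symm
  -- polarisation
  have h2le : ((2 : ℕ) : ℕ∞ω) ≤ ∞ := by
    rw [show ((2 : ℕ) : ℕ∞ω) = (((2 : ℕ) : ℕ∞) : ℕ∞ω) from (WithTop.coe_natCast 2).symm]
    exact WithTop.coe_le_coe.2 le_top
  have hF2 : ContDiff ℝ ((2 : ℕ) : ℕ∞ω) F := hF.of_le h2le
  have hsymm : IsSymmSndFDerivAt ℝ F y₀ := hF2.contDiffAt.isSymmSndFDerivAt (by simp)
  have hB : ∀ u v : W, fderiv ℝ (fderiv ℝ F) y₀ u v = 0 := by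
    intro u v
    have hq := hd2 (u + v)
    simp only [map_add, add_apply, hd2 u, hd2 v, zero_add, add_zero] at hq
    rw [hsymm v u] at hq
    have : (2 : ℝ) • fderiv ℝ (fderiv ℝ F) y₀ u v = 0 := by rw [two_smul]; exact hq
    exact (smul_eq_zero.1 this).resolve_left two_ne_zero
  intro k hk
  interval_cases k
  · ext m; simp [h0]
  · ext m; rw [iteratedFDeriv_one_apply, hd1]; simp
  · ext m; rw [iteratedFDeriv_two_apply, hB]; simp

/-- **Flatness to order `2` along a line is preserved under multiplication by a `C²` factor**
(Leibniz): if `g(0) = 0`, `g'(0) = 0`, `g''(0) = 0` (in the sense of `HasDerivAt` data near `0`)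
then the same holds for `g · a`. [folklore] -/
theorem line_flat_two_mul {g a g' a' : ℝ → ℂ} {g'' a'' : ℂ} (hg0 : g 0 = 0) (hg'0 : g' 0 = 0)
    (hg : ∀ᶠ s in 𝓝 (0 : ℝ), HasDerivAt g (g' s) s) (hg' : HasDerivAt g' g'' 0) (hg'' : g'' = 0)
    (ha : ∀ᶠ s in 𝓝 (0 : ℝ), HasDerivAt a (a' s) s) (ha' : HasDerivAt a' a'' 0) :
    (g * a) 0 = 0 ∧ HasDerivAt (g * a) 0 0 ∧ iteratedDeriv 2 (g * a) 0 = 0 := by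
  have hga : ∀ᶠ s in 𝓝 (0 : ℝ), HasDerivAt (g * a) (g' s * a s + g s * a' s) s := by
    filter_upwards [hg, ha] with s hgs has using hgs.mul has
  refine ⟨by simp [hg0], ?_, ?_⟩
  · have h := hga.self_of_nhds
    simpa [hg0, hg'0] using h
  · have hderiv : deriv (g * a) =ᶠ[𝓝 0] fun s ↦ g' s * a s + g s * a' s := by
      filter_upwards [hga] with s hs using hs.deriv
    have hg0' : HasDerivAt g (g' 0) 0 := hg.self_of_nhds
    have ha0' : HasDerivAt a (a' 0) 0 := ha.self_of_nhds
    have h2 : HasDerivAt (fun s ↦ g' s * a s + g s * a' s)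
        (g'' * a 0 + g' 0 * a' 0 + (g' 0 * a' 0 + g 0 * a'')) 0 :=
      (hg'.mul ha0').add (hg0'.mul ha')
    rw [iteratedDeriv_succ, iteratedDeriv_one, hderiv.deriv_eq, h2.deriv, hg0, hg'0, hg'']
    simp

end Bridge


end GaussianBeam

end Literature.Geometry.Lorentzian

end
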